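import Literature.AnabelianGeometry.AbsoluteAnabelian.PseudoShadows
import Literature.AnabelianGeometry.AbsoluteAnabelian.DiagramComap

/-!
# Invariance of the canonical family of a pseudo-commuting shadow under a graph morphism fixing the
# diagram and the shadow ([AbsTopIII] Def. 3.5 (ii), (v))

S. Mochizuki, *Topics in Absolute Anabelian Geometry III*, Def. 3.5 (i), (ii), (v) pp. 74–77 of the kurims
manuscript (`paper:url-5493eb38cbb7`; bib key `MochizukiAbsTopIII2015`).  Sequel of `PseudoShadows.lean`
(abc-iut-L4-t12) on the pattern of abc-iut-w6-d023's `DiagramShiftInvarianceLifts.lean` (which treats the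
structure functors `OverData` and the universal family `univFamily`); seat abc-iut-L4-t5 (gen 7), toolkit for the
`Φ_m`-compatibility (Def. 3.5 (v)) of the canonical shadow family `K'` realising `𝔗_δ` and `ℋ_δ` in [AbsTopIII]
Cor. 3.7 (v), final sentence:

* `DiagramOfCategories.pathFunctor'_comapAlong` — the structural path functors of `F^*𝒟` ARE those of `𝒟`
  along `F`;
* `PseudoShadow.comapAlong S F` — the shadow `F^*S` of `F^*𝒟` (shadow categories, augmentations, edge shadows and
  edge 2-cells re-indexed along `F`); `shP_comapAlong`, `canH_comapAlong(_heq)`, `canI_comapAlong(_heq)` — its path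
  shadows and coherence 2-cells are those of `S` along `F`; `univ_comapAlong` — so are its universal homotopies
  (uniqueness, `PseudoShadow.univ_eq`);
* `PseudoShadow.heq_of_eq`, `univ_heq_of_eq` — shadows on EQUAL diagrams agreeing datum by datum are
  (heterogeneously) equal, and then so are their universal homotopies;
* `univ_mapPath_heq`, `shadowFamily_η_mapPath_heq` — **invariance of the canonical family** `S.shadowFamily ff`
  (boundary set "equal shadows", universal homotopies) under `F` with `F^*𝒟 = 𝒟`, `F^*S ≍ S` and the SAME
  full-faithfulness witnesses at `b` and `F b`: the homotopy of `(F[γ₁], F[γ₂])` is (heterogeneously) that of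
  `([γ₁],[γ₂])` — the input `hη` of abc-iut-w6-d023's `OneMorphism.compatibleWithOfInvariant`
  (`DiagramShiftInvariance.lean`).

Pure category-theoretic plumbing; no claim of the paper is asserted; nothing here bears on [IUTchIII] Cor. 3.12.
-/

namespace Literature.AnabelianGeometry.AbsoluteAnabelian

open _root_.CategoryTheory _root_.Quiver

universe v u w w'

namespace DiagramOfCategories

variable {V : Type w} [Quiver.{v} V] {V' : Type w'} [Quiver.{v} V']
  (D : DiagramOfCategories.{v, u, w} V) (F : V' ⥤q V)

/-! ### The structural path functors of `F^*𝒟` -/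

/-- The structural path functors of `F^*𝒟` are those of `𝒟` along `F`: `(F^*𝒟)_{[γ]} = 𝒟_{F[γ]}` (the
`pathFunctor'` twin of `pathFunctor_comapAlong`). [cite: MochizukiAbsTopIII2015, Definition 3.5 (i) p.75] -/
theorem pathFunctor'_comapAlong {a : V'} : ∀ {b : V'} (p : Path a b),
    (D.comapAlong F).pathFunctor' p = D.pathFunctor' (F.mapPath p)
  | _, .nil => rfl
  | _, .cons p e => by
    rw [pathFunctor'_cons, Prefunctor.mapPath_cons, pathFunctor'_cons, pathFunctor'_comapAlong p]

/-- Objects: `(F^*𝒟)_{[γ]} x = 𝒟_{F[γ]} x`. [cite: MochizukiAbsTopIII2015, Definition 3.5 (i) p.75] -/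
theorem pathFunctor'_comapAlong_obj {a b : V'} (p : Path a b) (x : D.obj (F.obj a)) :
    ((D.comapAlong F).pathFunctor' p).obj x = (D.pathFunctor' (F.mapPath p)).obj x :=
  Functor.congr_obj (D.pathFunctor'_comapAlong F p) x

namespace PseudoShadow

variable {D}
variable (S : D.PseudoShadow)

/-! ### The shadow pulled back along a graph morphism -/

/-- **`F^*S`**: a pseudo-commuting shadow of `𝒟` pulled back along a morphism of oriented graphs `F` to a
pseudo-commuting shadow of `F^*𝒟` (shadow category at `v'` = that at `F v'`, and likewise for the augmentations,
the edge shadows and the edge 2-cells). [cite: MochizukiAbsTopIII2015, Definition 3.5 (ii) p.75] -/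
abbrev comapAlong : (D.comapAlong F).PseudoShadow where
  Sh a := S.Sh (F.obj a)
  aug a := S.aug (F.obj a)
  she e := S.she (F.map e)
  can e := S.can (F.map e)

/-- The path shadows of `F^*S` are those of `S` along `F`. [cite: MochizukiAbsTopIII2015, Definition 3.5 (i) p.75] -/
theorem shP_comapAlong {a : V'} : ∀ {b : V'} (p : Path a b), (S.comapAlong F).shP p = S.shP (F.mapPath p)
  | _, .nil => rfl
  | _, .cons p e => by rw [shP_cons, Prefunctor.mapPath_cons, shP_cons, shP_comapAlong p]

/-- Objects: `sh^{F^*S}_{[γ]} y = sh_{F[γ]} y`. [cite: MochizukiAbsTopIII2015, Definition 3.5 (i) p.75] -/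
theorem shP_comapAlong_obj {a b : V'} (p : Path a b) (y : S.Sh (F.obj a)) :
    ((S.comapAlong F).shP p).obj y = (S.shP (F.mapPath p)).obj y :=
  Functor.congr_obj (S.shP_comapAlong F p) y

/-- Congruence for the recursion step of `can_[γ]` (all object identifications propositional). [folklore] -/
private theorem canE_comp_map_heq {a b : V} (e : a ⟶ b) {z₁ z₂ : D.obj a} (hz : z₁ = z₂)
    {W₁ W₂ : S.Sh a} (hW : W₁ = W₂) {f₁ : (S.aug a).obj z₁ ⟶ W₁} {f₂ : (S.aug a).obj z₂ ⟶ W₂}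
    (hf : HEq f₁ f₂) : HEq (S.canE e z₁ ≫ (S.she e).map f₁) (S.canE e z₂ ≫ (S.she e).map f₂) := by
  subst hz; subst hW; cases hf; rfl

/-- Congruence for the recursion step of `can_[γ]⁻¹`. [folklore] -/
private theorem map_comp_canEI_heq {a b : V} (e : a ⟶ b) {z₁ z₂ : D.obj a} (hz : z₁ = z₂)
    {W₁ W₂ : S.Sh a} (hW : W₁ = W₂) {f₁ : W₁ ⟶ (S.aug a).obj z₁} {f₂ : W₂ ⟶ (S.aug a).obj z₂}
    (hf : HEq f₁ f₂) : HEq ((S.she e).map f₁ ≫ S.canEI e z₁) ((S.she e).map f₂ ≫ S.canEI e z₂) := by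
  subst hz; subst hW; cases hf; rfl

/-- **The coherence 2-cells of `F^*S` are those of `S` along `F`** (heterogeneously, along the object
identifications). [cite: MochizukiAbsTopIII2015, Definition 3.5 (ii) p.75] -/
theorem canH_comapAlong_heq {a : V'} : ∀ {b : V'} (p : Path a b) (x : D.obj (F.obj a)),
    HEq ((S.comapAlong F).canH p x) (S.canH (F.mapPath p) x)
  | _, .nil, _ => HEq.rfl
  | _, .cons p e, x => by
    change HEq (S.canE (F.map e) (((D.comapAlong F).pathFunctor' p).obj x) ≫
        (S.she (F.map e)).map ((S.comapAlong F).canH p x))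
      (S.canE (F.map e) ((D.pathFunctor' (F.mapPath p)).obj x) ≫
        (S.she (F.map e)).map (S.canH (F.mapPath p) x))
    exact S.canE_comp_map_heq (F.map e) (D.pathFunctor'_comapAlong_obj F p x)
      (S.shP_comapAlong_obj F p _) (canH_comapAlong_heq p x)

/-- The inverse coherence 2-cells of `F^*S` are those of `S` along `F` (heterogeneously).
[cite: MochizukiAbsTopIII2015, Definition 3.5 (ii) p.75] -/
theorem canI_comapAlong_heq {a : V'} : ∀ {b : V'} (p : Path a b) (x : D.obj (F.obj a)),
    HEq ((S.comapAlong F).canI p x) (S.canI (F.mapPath p) x)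
  | _, .nil, _ => HEq.rfl
  | _, .cons p e, x => by
    change HEq ((S.she (F.map e)).map ((S.comapAlong F).canI p x) ≫
        S.canEI (F.map e) (((D.comapAlong F).pathFunctor' p).obj x))
      ((S.she (F.map e)).map (S.canI (F.mapPath p) x) ≫
        S.canEI (F.map e) ((D.pathFunctor' (F.mapPath p)).obj x))
    exact S.map_comp_canEI_heq (F.map e) (D.pathFunctor'_comapAlong_obj F p x)
      (S.shP_comapAlong_obj F p _) (canI_comapAlong_heq p x)

/-- `can^{F^*S}_{[γ]} = eqToHom ≫ can_{F[γ]} ≫ eqToHom`. [cite: MochizukiAbsTopIII2015, Definition 3.5 (ii) p.75] -/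
theorem canH_comapAlong {a b : V'} (p : Path a b) (x : D.obj (F.obj a)) :
    (S.comapAlong F).canH p x =
      eqToHom (congrArg (S.aug (F.obj b)).obj (D.pathFunctor'_comapAlong_obj F p x)) ≫
        S.canH (F.mapPath p) x ≫ eqToHom (S.shP_comapAlong_obj F p ((S.aug (F.obj a)).obj x)).symm :=
  (conj_eqToHom_iff_heq' _ _ _ _).mpr (S.canH_comapAlong_heq F p x)

/-- `(can^{F^*S}_{[γ]})⁻¹ = eqToHom ≫ can_{F[γ]}⁻¹ ≫ eqToHom`. [cite: MochizukiAbsTopIII2015, Definition 3.5 (ii) p.75] -/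
theorem canI_comapAlong {a b : V'} (p : Path a b) (x : D.obj (F.obj a)) :
    (S.comapAlong F).canI p x =
      eqToHom (S.shP_comapAlong_obj F p ((S.aug (F.obj a)).obj x)) ≫ S.canI (F.mapPath p) x ≫
        eqToHom (congrArg (S.aug (F.obj b)).obj (D.pathFunctor'_comapAlong_obj F p x)).symm :=
  (conj_eqToHom_iff_heq' _ _ _ _).mpr (S.canI_comapAlong_heq F p x)

/-- **The universal homotopies of `F^*S` are those of `S` along `F`** (heterogeneously, along
`(F^*𝒟)_{[γ]} = 𝒟_{F[γ]}`): the `eqToHom`-conjugate of `ζ_{(F[γ₁],F[γ₂])}` lies over `can ≫ can⁻¹`, hence IS the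
universal homotopy of `([γ₁],[γ₂])` in `F^*𝒟` (uniqueness). [cite: MochizukiAbsTopIII2015, Definition 3.5 (ii) p.75] -/
theorem univ_comapAlong {a b : V'} (hb : (S.aug (F.obj b)).FullyFaithful) (p q : Path a b)
    (h : (S.comapAlong F).shP p = (S.comapAlong F).shP q)
    (h' : S.shP (F.mapPath p) = S.shP (F.mapPath q)) :
    HEq ((S.comapAlong F).univ hb p q h) (S.univ hb (F.mapPath p) (F.mapPath q) h') := by
  have key : eqToHom (D.pathFunctor'_comapAlong F p) ≫ S.univ hb (F.mapPath p) (F.mapPath q) h' ≫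
      eqToHom (D.pathFunctor'_comapAlong F q).symm = (S.comapAlong F).univ hb p q h := by
    refine (S.comapAlong F).univ_eq hb h _ fun x => ?_
    change (S.aug (F.obj b)).map _ = _
    rw [NatTrans.comp_app, NatTrans.comp_app, eqToHom_app, eqToHom_app, Functor.map_comp,
      Functor.map_comp, eqToHom_map, eqToHom_map, S.map_univ_app hb, S.canH_comapAlong F p x,
      S.canI_comapAlong F q x]
    simp only [Category.assoc, eqToHom_trans_assoc]
  rw [← key]
  exact HomotopyFamily.heq_eqToHom_comp_comp_eqToHom _ _ _

/-! ### Shadows on equal diagrams -/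

/-- Pseudo-commuting shadows on EQUAL diagrams that agree datum by datum (shadow categories, augmentations,
edge shadows, edge 2-cells) are (heterogeneously) equal. [cite: MochizukiAbsTopIII2015, Definition 3.5 (ii) p.75] -/
theorem heq_of_eq {D₁ D₂ : DiagramOfCategories.{v, u, w} V} (hD : D₁ = D₂) {S₁ : D₁.PseudoShadow}
    {S₂ : D₂.PseudoShadow} (hSh : ∀ a : V, S₁.Sh a = S₂.Sh a) (haug : ∀ a : V, HEq (S₁.aug a) (S₂.aug a))
    (hshe : ∀ ⦃a b : V⦄ (e : a ⟶ b), HEq (S₁.she e) (S₂.she e))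
    (hcan : ∀ ⦃a b : V⦄ (e : a ⟶ b), HEq (S₁.can e) (S₂.can e)) : HEq S₁ S₂ := by
  subst hD
  obtain ⟨Sh₁, aug₁, she₁, can₁⟩ := S₁
  obtain ⟨Sh₂, aug₂, she₂, can₂⟩ := S₂
  obtain rfl : Sh₁ = Sh₂ := funext hSh
  obtain rfl : aug₁ = aug₂ := funext fun a => eq_of_heq (haug a)
  have hshe' : @she₁ = @she₂ := by
    funext a b e
    exact eq_of_heq (hshe e)
  subst hshe'
  have hcan' : @can₁ = @can₂ := by
    funext a b e
    exact eq_of_heq (hcan e)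
  subst hcan'
  rfl

/-- The universal homotopies are invariant under (heterogeneous) equality of all the data.
[cite: MochizukiAbsTopIII2015, Definition 3.5 (ii) p.75] -/
theorem univ_heq_of_eq {D₁ D₂ : DiagramOfCategories.{v, u, w} V} (hD : D₁ = D₂) {S₁ : D₁.PseudoShadow}
    {S₂ : D₂.PseudoShadow} (hS : HEq S₁ S₂) {a b : V} {hb₁ : (S₁.aug b).FullyFaithful}
    {hb₂ : (S₂.aug b).FullyFaithful} (hhb : HEq hb₁ hb₂) (p q : Path a b) (h₁ : S₁.shP p = S₁.shP q)
    (h₂ : S₂.shP p = S₂.shP q) : HEq (S₁.univ hb₁ p q h₁) (S₂.univ hb₂ p q h₂) := by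
  subst hD; cases hS; cases hhb; rfl

/-! ### Invariance of the canonical family -/

/-- **Invariance of the universal homotopies under a graph morphism fixing the diagram and the shadow**: if
`F^*𝒟 = 𝒟` and `F^*S ≍ S` (with the same full-faithfulness witnesses at `b` and `F b`), the universal homotopy
of `(F[γ₁], F[γ₂])` is (heterogeneously) that of `([γ₁],[γ₂])`. [cite: MochizukiAbsTopIII2015, Definition 3.5 (v) p.76] -/
theorem univ_mapPath_heq (G : V ⥤q V) (hD : D.comapAlong G = D) (hS : HEq (S.comapAlong G) S) {a b : V}
    (hb : (S.aug (G.obj b)).FullyFaithful) (hb' : (S.aug b).FullyFaithful) (hbb : HEq hb hb')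
    (p q : Path a b) (h : S.shP p = S.shP q) (h' : S.shP (G.mapPath p) = S.shP (G.mapPath q)) :
    HEq (S.univ hb (G.mapPath p) (G.mapPath q) h') (S.univ hb' p q h) := by
  have hc : (S.comapAlong G).shP p = (S.comapAlong G).shP q := by
    rw [S.shP_comapAlong G p, S.shP_comapAlong G q]; exact h'
  exact (S.univ_comapAlong G hb p q hc h').symm.trans (univ_heq_of_eq hD hS (hb₁ := hb) hbb p q hc h)

/-- **Invariance of the canonical family of homotopies** `S.shadowFamily ff` (boundary set "equal shadows",
universal homotopies; Def. 3.5 (ii)) under a graph morphism `F` with `F^*𝒟 = 𝒟`, `F^*S ≍ S` and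
`ff (F b) ≍ ff b`: the homotopy of `(F[γ₁], F[γ₂])` is (heterogeneously) that of `([γ₁],[γ₂])` — the input `hη`
of `OneMorphism.compatibleWithOfInvariant` (Def. 3.5 (v) compatibility from invariance).
[cite: MochizukiAbsTopIII2015, Definition 3.5 (v) p.76] -/
theorem shadowFamily_η_mapPath_heq (ff : ∀ b : V, (S.aug b).FullyFaithful) (G : V ⥤q V)
    (hD : D.comapAlong G = D) (hS : HEq (S.comapAlong G) S) (hff : ∀ b : V, HEq (ff (G.obj b)) (ff b))
    {a b : V} {p q : Path a b} (h : (S.shadowFamily ff).E p q)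
    (h' : (S.shadowFamily ff).E (G.mapPath p) (G.mapPath q)) :
    HEq ((S.shadowFamily ff).η h') ((S.shadowFamily ff).η h) := by
  change HEq (eqToHom (D.pathFunctor_eq_pathFunctor' _) ≫
      S.univ (ff (G.obj b)) (G.mapPath p) (G.mapPath q) h' ≫ eqToHom (D.pathFunctor_eq_pathFunctor' _).symm)
    (eqToHom (D.pathFunctor_eq_pathFunctor' _) ≫ S.univ (ff b) p q h ≫
      eqToHom (D.pathFunctor_eq_pathFunctor' _).symm)
  exact (HomotopyFamily.heq_eqToHom_comp_comp_eqToHom _ _ _).trans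
    ((S.univ_mapPath_heq G hD hS _ _ (hff b) p q h h').trans
      (HomotopyFamily.heq_eqToHom_comp_comp_eqToHom _ _ _).symm)

end PseudoShadow

end DiagramOfCategories

end Literature.AnabelianGeometry.AbsoluteAnabelian
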